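import Summits.QuantumFields.YangMills.Theorems.ColdStartUniversalityLatticeLangevinWeightedDynkinSlope
import Summits.QuantumFields.YangMills.Theorems.ColdStartUniversalityLatticeLangevinWilsonLogSobolev
import HarnessLib

/-!
# Route `ColdStartUniversality` (fixed-cut-off package, entropy side): the ENTROPY SLOPE INEQUALITY — exponential decay of the entropy
# of ONE positive cylinder density forces `4ρ·Ent_μ(Q) ≤ −∫ log Q · 𝓛q dμ` (first half of BGL Thm 5.2.1 (ii)⇒(i))

Helper file (seat `ym-line-csu-p1`, g22; `--supports stmt-QuantumFields-27363`).  For the SU(2) SZZ dynamics at `(L, β')`, `μ = μ_{β'}`,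
a realising kernel family `κ`, a `C³` compactly supported `q` with `Q = q∘coords > 0` on the group:

* `log_mul_sub_le_mul_log_sub` — convexity of `φ(u) = u log u`: `log t·(u − t) ≤ φ(u) − φ(t) − (u − t)` (`u ≥ 0 < t`);
* ★★ `four_mul_entropy_le_neg_integral_log_mul_generator` — if `Ent_μ(κ_t Q) ≤ e^{−4ρt} Ent_μ(Q)` for all `t`, then
  `4ρ·Ent_μ(Q) ≤ −∫ log Q · 𝓛q dμ`: by convexity `∫ log Q (κ_τQ − Q) dμ ≤ Ent(κ_τQ) − Ent(Q) ≤ (e^{−4ρτ} − 1) Ent(Q)` (masses are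
  equal by invariance), divide by `τ` and let `τ ↓ 0` with the weighted Dynkin slope `tendsto_weighted_transition_slope` (g22) and
  the derivative of `e^{−4ρτ}` at `0`;
* `carre_log_mul_self_add_const` — the pointwise chain rule `Γ(log(g²+η), g²) = (4g²/(g²+η))·Γ(g,g)` behind the second half.

THEOREMS ONLY, no definition, no sorry.  RECORD-rung R3 plumbing at fixed cut-off; nothing K-uniform; no crux, rung or summit
statement is proved; the Yang–Mills mass gap is NOT proved.
-/

set_option autoImplicit false

noncomputable section

namespace Summit.QuantumFields.YangMills.Theorems.ColdStartUniversality

open MeasureTheory ProbabilityTheory Finset Filter Set Topology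
open scoped BigOperators NNReal ENNReal
open Literature.Probability.Process Literature.MathematicalPhysics.QuantumFieldTheory
open Literature.MathematicalPhysics.QuantumLattice (fundamentalRep fundamentalLatticeRep continuous_fundamentalRep)

variable {L : ℕ} [NeZero L]

/-! ## §1. Convexity of `u log u` -/

/-- **Tangent-line inequality for `φ(u) = u log u`**: `log t · (u − t) ≤ (u log u − t log t) − (u − t)` for `u ≥ 0`, `t > 0`
(`= Literature…mul_log_sub_mul_log_sub_add_nonneg` rearranged). [folklore] -/
theorem log_mul_sub_le_mul_log_sub {u t : ℝ} (hu : 0 ≤ u) (ht : 0 < t) :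
    Real.log t * (u - t) ≤ (u * Real.log u - t * Real.log t) - (u - t) := by
  have h := Literature.Probability.MarkovChains.mul_log_sub_mul_log_sub_add_nonneg hu ht
  nlinarith [h]

/-! ## §2. ★★ The entropy slope inequality -/

/-- ★★ **Entropy slope inequality.**  Let `κ` realise the SZZ transition laws at `(L, β')`, `q` a `C³` compactly supported function of
the real link coordinates with `Q = q∘coords > 0` on `SU(2)^E`, and assume `Ent_μ(κ_t Q) ≤ e^{−4ρt}·Ent_μ(Q)` for every lattice time
`t` (`μ = μ_{β'}`, `Ent_μ(w) = ∫ w log w dμ − (∫ w dμ) log(∫ w dμ)`).  Then `4ρ·Ent_μ(Q) ≤ −∫ log Q · 𝓛q dμ`.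
[cite: BakryGentilLedoux2014, Thm 5.2.1 (ii)⇒(i)] -/
theorem four_mul_entropy_le_neg_integral_log_mul_generator (L : ℕ) [NeZero L] (β' : ℝ)
    (κ : ℝ≥0 → Kernel (GaugeConfig 3 L (Matrix.specialUnitaryGroup (Fin 2) ℂ))
      (GaugeConfig 3 L (Matrix.specialUnitaryGroup (Fin 2) ℂ))) [∀ t, IsMarkovKernel (κ t)]
    (hreal : ∀ (t : ℝ≥0) (x : GaugeConfig 3 L (Matrix.specialUnitaryGroup (Fin 2) ℂ))
        (Ω : Type) [MeasurableSpace Ω] (P : Measure Ω) [IsProbabilityMeasure P]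
        (W : ℝ≥0 → Ω → (Edge 3 L × NoiseIdx 2 → ℝ)) (hW : IsFlatBrownian W P)
        (U : ℝ≥0 → Ω → GaugeConfig 3 L (Matrix.specialUnitaryGroup (Fin 2) ℂ)),
        (∀ ω, U 0 ω = x) →
        (latticeLangevinDynamics (fundamentalLatticeRep 2) β').IsSolution (fundamentalRep (Fin 2))
          hW.natFiltration P W U →
        κ t x = P.map (U t))
    {q : (Edge 3 L × Fin 2 × Fin 2 × Bool → ℝ) → ℝ} (hq : ContDiff ℝ 3 q) (hqc : HasCompactSupport q)
    (hpos : ∀ x : GaugeConfig 3 L (Matrix.specialUnitaryGroup (Fin 2) ℂ),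
      0 < q (fun p => (fun z : ℂ => if p.2.2.2 then z.im else z.re)
        ((fundamentalRep (Fin 2) (x p.1) : Matrix (Fin 2) (Fin 2) ℂ) p.2.1 p.2.2.1)))
    {ρ : ℝ}
    (hdecay : ∀ t : ℝ≥0,
      let Q : GaugeConfig 3 L (Matrix.specialUnitaryGroup (Fin 2) ℂ) → ℝ := fun x =>
        q (fun p => (fun z : ℂ => if p.2.2.2 then z.im else z.re)
          ((fundamentalRep (Fin 2) (x p.1) : Matrix (Fin 2) (Fin 2) ℂ) p.2.1 p.2.2.1))
      (∫ x, (∫ y, Q y ∂(κ t x)) * Real.log (∫ y, Q y ∂(κ t x)) ∂(wilsonMeasure (d := 3) (L := L) (fundamentalRep (Fin 2)) β')) -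
          (∫ x, (∫ y, Q y ∂(κ t x)) ∂(wilsonMeasure (d := 3) (L := L) (fundamentalRep (Fin 2)) β')) *
            Real.log (∫ x, (∫ y, Q y ∂(κ t x)) ∂(wilsonMeasure (d := 3) (L := L) (fundamentalRep (Fin 2)) β')) ≤
        Real.exp (-4 * ρ * t) *
          ((∫ x, Q x * Real.log (Q x) ∂(wilsonMeasure (d := 3) (L := L) (fundamentalRep (Fin 2)) β')) -
            (∫ x, Q x ∂(wilsonMeasure (d := 3) (L := L) (fundamentalRep (Fin 2)) β')) *
              Real.log (∫ x, Q x ∂(wilsonMeasure (d := 3) (L := L) (fundamentalRep (Fin 2)) β')))) :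
    let coords : GaugeConfig 3 L (Matrix.specialUnitaryGroup (Fin 2) ℂ) → (Edge 3 L × Fin 2 × Fin 2 × Bool → ℝ) :=
      fun V p => (fun z : ℂ => if p.2.2.2 then z.im else z.re)
        ((fundamentalRep (Fin 2) (V p.1) : Matrix (Fin 2) (Fin 2) ℂ) p.2.1 p.2.2.1)
    let gen : GaugeConfig 3 L (Matrix.specialUnitaryGroup (Fin 2) ℂ) → ℝ := fun V =>
      (∑ i : Edge 3 L × Fin 2 × Fin 2 × Bool, fderiv ℝ q (coords V) (Pi.single i 1) *
          (fun z : ℂ => if i.2.2.2 then z.im else z.re)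
            ((latticeLangevinDynamics (fundamentalLatticeRep 2) β').drift
              (matrixConfig (fundamentalRep (Fin 2)) V) i.1 i.2.1 i.2.2.1) +
      1 / 2 * ∑ i : Edge 3 L × Fin 2 × Fin 2 × Bool, ∑ j : Edge 3 L × Fin 2 × Fin 2 × Bool,
        fderiv ℝ (fun z => fderiv ℝ q z (Pi.single i 1)) (coords V) (Pi.single j 1) *
          ∑ n : Edge 3 L × NoiseIdx 2,
            (if n.1 = i.1 then (fun z : ℂ => if i.2.2.2 then z.im else z.re)
              ((latticeLangevinDynamics (fundamentalLatticeRep 2) β').noise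
                (matrixConfig (fundamentalRep (Fin 2)) V) i.1 n.2 i.2.1 i.2.2.1) else 0) *
            (if n.1 = j.1 then (fun z : ℂ => if j.2.2.2 then z.im else z.re)
              ((latticeLangevinDynamics (fundamentalLatticeRep 2) β').noise
                (matrixConfig (fundamentalRep (Fin 2)) V) j.1 n.2 j.2.1 j.2.2.1) else 0))
    4 * ρ * ((∫ V, q (coords V) * Real.log (q (coords V)) ∂(wilsonMeasure (d := 3) (L := L) (fundamentalRep (Fin 2)) β')) -
        (∫ V, q (coords V) ∂(wilsonMeasure (d := 3) (L := L) (fundamentalRep (Fin 2)) β')) *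
          Real.log (∫ V, q (coords V) ∂(wilsonMeasure (d := 3) (L := L) (fundamentalRep (Fin 2)) β'))) ≤
      -∫ V, Real.log (q (coords V)) * gen V ∂(wilsonMeasure (d := 3) (L := L) (fundamentalRep (Fin 2)) β') := by
  intro coords gen
  classical
  haveI := secondCountableTopology_su2
  haveI := borelSpace_config L
  set μ : Measure (GaugeConfig 3 L (Matrix.specialUnitaryGroup (Fin 2) ℂ)) :=
    wilsonMeasure (d := 3) (L := L) (fundamentalRep (Fin 2)) β' with hμ
  haveI : IsProbabilityMeasure μ :=
    isProbabilityMeasure_wilsonMeasure (d := 3) (L := L) (fundamentalRep (Fin 2)) (continuous_fundamentalRep (Fin 2)) β'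
  set Q : GaugeConfig 3 L (Matrix.specialUnitaryGroup (Fin 2) ℂ) → ℝ := fun V => q (coords V) with hQdef
  have hco : Continuous coords := continuous_coords (L := L)
  have hQc : Continuous Q := hq.continuous.comp hco
  obtain ⟨δ, hδ, hδQ⟩ := exists_pos_le_of_continuous_of_compactSpace hQc hpos
  obtain ⟨M, -, hM⟩ := exists_abs_le_of_continuous_of_compactSpace hQc
  have hQpos : ∀ x, 0 < Q x := hpos
  -- the weight `H = log Q` is continuous
  set H : GaugeConfig 3 L (Matrix.specialUnitaryGroup (Fin 2) ℂ) → ℝ := fun V => Real.log (Q V) with hHdef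
  have hHc : Continuous H := Real.continuousOn_log.comp_continuous hQc fun x => (hQpos x).ne'
  -- the transition `u_τ = κ_τ Q`
  have huc : ∀ τ : ℝ≥0, Continuous fun x => ∫ y, Q y ∂(κ τ x) := fun τ =>
    (continuous_transitionKernel_action β' κ hreal hQc).comp (continuous_const.prodMk continuous_id)
  have hu0 : ∀ (τ : ℝ≥0) x, 0 ≤ ∫ y, Q y ∂(κ τ x) := fun τ x => integral_nonneg fun y => (hQpos y).le
  have humass : ∀ τ : ℝ≥0, ∫ x, (∫ y, Q y ∂(κ τ x)) ∂μ = ∫ x, Q x ∂μ := fun τ =>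
    integral_transitionKernel_integral_eq_wilson (L := L) β' κ hreal τ hQc.measurable ⟨M, hM⟩
  set E : ℝ := (∫ V, Q V * Real.log (Q V) ∂μ) - (∫ V, Q V ∂μ) * Real.log (∫ V, Q V ∂μ) with hE
  -- the key inequality for `τ > 0`: `∫ H κ_τQ − ∫ H Q ≤ (e^{−4ρτ} − 1)·E`
  have hkey : ∀ τ : ℝ, 0 < τ →
      (∫ V, H V * (∫ y, Q y ∂(κ τ.toNNReal V)) ∂μ) - ∫ V, H V * Q V ∂μ ≤ (Real.exp (-4 * ρ * τ) - 1) * E := by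
    intro τ hτ
    set u : GaugeConfig 3 L (Matrix.specialUnitaryGroup (Fin 2) ℂ) → ℝ := fun x => ∫ y, Q y ∂(κ τ.toNNReal x) with hudef
    have huc' : Continuous u := huc _
    have hφuc : Continuous fun x => u x * Real.log (u x) := Real.continuous_mul_log.comp huc'
    have hφQc : Continuous fun x => Q x * Real.log (Q x) := Real.continuous_mul_log.comp hQc
    -- pointwise convexity
    have hpt : ∀ x, H x * u x - H x * Q x ≤ (u x * Real.log (u x) - Q x * Real.log (Q x)) - (u x - Q x) := by
      intro x
      have h := log_mul_sub_le_mul_log_sub (hu0 τ.toNNReal x) (hQpos x)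
      simp only [hHdef]
      linarith [h]
    have i1 : Integrable (fun x => H x * u x) μ := integrable_of_continuous_of_compactSpace (hHc.mul huc') μ
    have i2 : Integrable (fun x => H x * Q x) μ := integrable_of_continuous_of_compactSpace (hHc.mul hQc) μ
    have i3 : Integrable (fun x => u x * Real.log (u x)) μ := integrable_of_continuous_of_compactSpace hφuc μ
    have i4 : Integrable (fun x => Q x * Real.log (Q x)) μ := integrable_of_continuous_of_compactSpace hφQc μ
    have i5 : Integrable u μ := integrable_of_continuous_of_compactSpace huc' μ
    have i6 : Integrable Q μ := integrable_of_continuous_of_compactSpace hQc μ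
    have iL : Integrable (fun x => H x * u x - H x * Q x) μ := i1.sub i2
    have i34 : Integrable (fun x => u x * Real.log (u x) - Q x * Real.log (Q x)) μ := i3.sub i4
    have i56 : Integrable (fun x => u x - Q x) μ := i5.sub i6
    have iR : Integrable (fun x => (u x * Real.log (u x) - Q x * Real.log (Q x)) - (u x - Q x)) μ := i34.sub i56
    have hint := integral_mono iL iR hpt
    rw [integral_sub i1 i2, integral_sub i34 i56, integral_sub i3 i4, integral_sub i5 i6] at hint
    have hm : ∫ x, u x ∂μ = ∫ x, Q x ∂μ := humass _
    -- the decay hypothesis at `τ`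
    have hd := hdecay τ.toNNReal
    have hτ' : ((τ.toNNReal : ℝ≥0) : ℝ) = τ := Real.coe_toNNReal _ hτ.le
    simp only [hτ'] at hd
    change (∫ x, u x * Real.log (u x) ∂μ) - (∫ x, u x ∂μ) * Real.log (∫ x, u x ∂μ) ≤
      Real.exp (-4 * ρ * τ) * E at hd
    rw [hm] at hd
    have hE' : E = (∫ V, Q V * Real.log (Q V) ∂μ) - (∫ V, Q V ∂μ) * Real.log (∫ V, Q V ∂μ) := hE
    nlinarith [hint, hd, hm, hE']
  -- divide by `τ` and let `τ ↓ 0`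
  have hslope := tendsto_weighted_transition_slope L β' κ hreal hq hqc hHc
  have hexp : Tendsto (fun τ : ℝ => τ⁻¹ * ((Real.exp (-4 * ρ * τ) - 1) * E)) (𝓝[>] 0) (𝓝 (-4 * ρ * E)) := by
    have hD : HasDerivAt (fun τ : ℝ => Real.exp (-4 * ρ * τ) * E) (-4 * ρ * E) 0 := by
      have h1 : HasDerivAt (fun τ : ℝ => -4 * ρ * τ) (-4 * ρ) 0 := by
        simpa using (hasDerivAt_id (0 : ℝ)).const_mul (-4 * ρ)
      have h2 := h1.exp.mul_const E
      simpa using h2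
    have h := hD.tendsto_slope_zero_right
    refine h.congr' (Eventually.of_forall fun τ => ?_)
    simp only [zero_add, mul_zero, Real.exp_zero, one_mul, smul_eq_mul]
    ring
  have hle : ∀ᶠ τ : ℝ in 𝓝[>] 0, τ⁻¹ * ((∫ V, H V * (∫ y, q (coords y) ∂(κ τ.toNNReal V)) ∂μ) -
      ∫ V, H V * q (coords V) ∂μ) ≤ τ⁻¹ * ((Real.exp (-4 * ρ * τ) - 1) * E) := by
    filter_upwards [self_mem_nhdsWithin] with τ hτ
    exact mul_le_mul_of_nonneg_left (hkey τ hτ) (inv_nonneg.2 (le_of_lt hτ))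
  have hlim : (∫ V, H V * gen V ∂μ) ≤ -4 * ρ * E := le_of_tendsto_of_tendsto hslope hexp hle
  have e : ∫ V, Real.log (q (coords V)) * gen V ∂μ = ∫ V, H V * gen V ∂μ := rfl
  rw [e]
  linarith

/-! ## §3. The pointwise chain rule `Γ(log(g²+η), g²) = (4g²/(g²+η))·Γ(g,g)` -/

/-- **Chain rule for the carré du champ**: for `g` differentiable at `c` and `η > 0`,
`Σ_{ij} ∂_i log(g²+η)(c) · ∂_j(g²)(c) · A_{ij} = (4g(c)²/(g(c)²+η)) · Σ_{ij} ∂_i g(c) ∂_j g(c) A_{ij}`. [folklore] -/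
theorem carre_log_mul_self_add_const {E : Type*} [NormedAddCommGroup E] [NormedSpace ℝ E] {ι : Type*} [Fintype ι]
    (v : ι → E) (A : ι → ι → ℝ) {g : E → ℝ} {c : E} (hg : DifferentiableAt ℝ g c) {η : ℝ} (hη : 0 < η) :
    ∑ i, ∑ j, fderiv ℝ (fun y => Real.log (g y * g y + η)) c (v i) * fderiv ℝ (fun y => g y * g y) c (v j) * A i j =
      (4 * (g c * g c) / (g c * g c + η)) * ∑ i, ∑ j, fderiv ℝ g c (v i) * fderiv ℝ g c (v j) * A i j := by
  have hpos : 0 < g c * g c + η := by nlinarith [mul_self_nonneg (g c)]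
  have hp : ∀ w, fderiv ℝ (fun y => g y * g y) c w = 2 * g c * fderiv ℝ g c w := fun w => by
    rw [fderiv_mul_apply_dir hg hg]; ring
  have h1 : HasFDerivAt (fun y => g y * g y + η) (fderiv ℝ (fun y => g y * g y) c) c :=
    ((hg.mul hg).hasFDerivAt).add_const η
  have h2 := h1.log hpos.ne'
  have hl : ∀ w, fderiv ℝ (fun y => Real.log (g y * g y + η)) c w = (g c * g c + η)⁻¹ * (2 * g c * fderiv ℝ g c w) := by
    intro w
    rw [h2.fderiv, FunLike.coe_smul, Pi.smul_apply, smul_eq_mul, hp]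
  simp_rw [hl, hp]
  rw [Finset.mul_sum]
  refine Finset.sum_congr rfl fun i _ => ?_
  rw [Finset.mul_sum]
  refine Finset.sum_congr rfl fun j _ => ?_
  field_simp
  ring

end Summit.QuantumFields.YangMills.Theorems.ColdStartUniversality

end
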